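import Summits.CriticalPhenomena.PercolationContinuityZ3.Theorems.Transplant.AutEndStateTypesTwist
import Mathlib.Combinatorics.SimpleGraph.Cayley
import Mathlib.Data.ZMod.QuotientGroup
import Mathlib.Algebra.Order.Group.End
import Mathlib.Tactic.IntervalCases
import HarnessLib

/-!
# The twist criterion, II: the GRR transfer for an arbitrary group; CYCLIC point groups whose non-trivial powers fix only the identity (`n ∣` index, `≥ n` types);
# a point group of order SIX (and THREE) on `ℤ²` exists — `p6`, `p3`

builds on p205010 (kernel theorem, internal audit signed; external expert review pending) — nothing in this file uses p205010; UNCONDITIONAL (pure group theory + an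
elementary Cayley-graph transfer); nothing is claimed about any open node.  Lane `prim-bschramm`, seat `prim-bschramm-p4` gen 28 (PART C3 of `P4-GENERAL.md` §50.11).
Helper file (`--supports stmt-CriticalPhenomena-4575 --as helper`); def-free.

* **`Twist.le_card_reps_of_grr`** — THE GRR TRANSFER for an arbitrary group `Γ`: if every subgroup of `Γ` carrying a rank-two `ℤ²`-character has index divisible by `n`,
  then on a Cayley graph `Cay(Γ; S)` all of whose automorphisms are left translations EVERY end-state datum `(A ≤ Aut, reps, c)` has `n ≤ |reps|` (evaluation at `1`
  embeds `A` into `Γ` with its character; the inverted representatives hit every coset).  (`ZWr.le_card_reps_of_grr` of `AutEndStateTypes` is the case `Γ = ℤ^p ⋊ C_p`.)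
* **`Twist.Cyclic.dvd_index` / `le_card_reps_of_grr`** — ANY cyclic point group `⟨ρ⟩ ≤ Aut(N)` (`N` abelian) of order `n` whose non-trivial powers fix only `1`:
  `n ∣ [N ⋊ ⟨ρ⟩ : A₀]` for every `A₀` with a rank-two `ℤ²`-character, `≥ n` types on a GRR.
* **`Twist.exists_pointGroup_six` / `exists_pointGroup_three`** — the rotation `(x, y) ↦ (x − y, x)` of `ℤ²` has order `6` and its non-trivial powers fix only the origin
  (its square has order `3` with the same property): the wallpaper groups `p6`, `p3` are instances — **`Twist.exists_grp_six_types`**: a split planar crystallographic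
  group on whose GRRs every end-state datum has at least SIX types.  (`p4 → 4`, `p2 → 2` with the concrete groups: `AutEndStateTypesPlanar`.)
[cite: BenjaminiSchramm1996, Conj. 4; §2 (Cayley graphs; almost transitive graphs)] [cite: KozmaNitzan2024, §4 p. 16 (Lemma 8: the role of the lattice symmetries)]
[cite: LeemannDelasalle2022, Cor. 1.2]
-/

noncomputable section

namespace Summit.CriticalPhenomena.PercolationContinuityZ3.Theorems.Transplant

open SimpleGraph Literature.Probability.LatticeModels
open scoped Classical

/-! ## §1 The GRR transfer for an arbitrary group -/

namespace Twist

/-- **THE GRR TRANSFER.**  `Γ` any group; suppose every subgroup of `Γ` carrying a `ℤ²`-character of rank two has index divisible by `n`.  Then on a Cayley graph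
`X = Cay(Γ; S)` all of whose automorphisms are left translations, every subgroup `A ≤ Aut(X)` with a rank-two `ℤ²`-character and a finite set `reps` of orbit
representatives has `n ≤ |reps|`. [cite: BenjaminiSchramm1996, §2 (Cayley graphs)] [cite: LeemannDelasalle2022, Cor. 1.2] -/
theorem le_card_reps_of_grr {Γ : Type} [Group Γ] (n : ℕ)
    (hdvd : ∀ (A₀ : Subgroup Γ) (c : A₀ →* Multiplicative (Site 2)),
      (∃ x y : A₀, MaxArea.det2 (Multiplicative.toAdd (c x)) (Multiplicative.toAdd (c y)) ≠ 0) → n ∣ A₀.index)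
    (S : Set Γ) (hGRR : ∀ α : mulCayley S ≃g mulCayley S, ∀ v : Γ, α v = α 1 * v)
    (A : Subgroup (mulCayley S ≃g mulCayley S)) (reps : Finset Γ) (cA : A →* Multiplicative (Site 2))
    (horb : ∀ w : Γ, ∃ x : A, ∃ s ∈ reps, (x : mulCayley S ≃g mulCayley S) s = w)
    (hrank : ∃ x y : A, MaxArea.det2 (Multiplicative.toAdd (cA x)) (Multiplicative.toAdd (cA y)) ≠ 0) : n ≤ reps.card := by
  -- evaluation at `1` is an injective homomorphism `A → Γ`
  let ev : A →* Γ :=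
    { toFun := fun x => (x : mulCayley S ≃g mulCayley S) 1
      map_one' := rfl
      map_mul' := fun x y => by
        show ((x : mulCayley S ≃g mulCayley S) * (y : mulCayley S ≃g mulCayley S)) 1 = _
        rw [RelIso.coe_mul, Function.comp_apply, hGRR (x : mulCayley S ≃g mulCayley S) ((y : mulCayley S ≃g mulCayley S) 1)] }
  have hev : ∀ x : A, ev x = (x : mulCayley S ≃g mulCayley S) 1 := fun x => rfl
  have hinj : Function.Injective ev := by
    intro x y hxy
    apply Subtype.ext
    apply RelIso.ext
    intro v
    rw [hGRR (x : mulCayley S ≃g mulCayley S) v, hGRR (y : mulCayley S ≃g mulCayley S) v, ← hev, ← hev, hxy]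
  let e : A ≃* ev.range := MonoidHom.ofInjective hinj
  let c : ev.range →* Multiplicative (Site 2) := cA.comp e.symm.toMonoidHom
  have hc : ∀ x : A, c (e x) = cA x := fun x => by
    show cA (e.symm (e x)) = cA x; rw [MulEquiv.symm_apply_apply]
  have hrank' : ∃ x y : ev.range, MaxArea.det2 (Multiplicative.toAdd (c x)) (Multiplicative.toAdd (c y)) ≠ 0 := by
    obtain ⟨x, y, hxy⟩ := hrank
    exact ⟨e x, e y, by rwa [hc, hc]⟩
  have hdvd' := hdvd ev.range c hrank'
  have hsurj : Function.Surjective (fun s : reps => (QuotientGroup.mk ((s : Γ)⁻¹) : Γ ⧸ ev.range)) := by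
    intro q
    induction q using QuotientGroup.induction_on with
    | H g =>
      obtain ⟨x, s, hs, hxs⟩ := horb g⁻¹
      refine ⟨⟨s, hs⟩, ?_⟩
      apply QuotientGroup.eq.2
      rw [inv_inv]
      have hxs' : ev x * s = g⁻¹ := by rw [hev, ← hGRR]; exact hxs
      have hsg : s * g = (ev x)⁻¹ := by
        have h := congrArg (fun z : Γ => z⁻¹) hxs'
        simp only [inv_inv] at h
        rw [← h, mul_inv_rev, mul_inv_cancel_left]
      rw [hsg]
      exact inv_mem ⟨x, rfl⟩
  haveI : Finite (Γ ⧸ ev.range) := Finite.of_surjective _ hsurj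
  have hidx : Nat.card (Γ ⧸ ev.range) ≤ reps.card := by
    have h := Nat.card_le_card_of_surjective _ hsurj
    rwa [Nat.card_eq_finsetCard] at h
  have hne : Nat.card (Γ ⧸ ev.range) ≠ 0 := (Nat.card_pos (α := Γ ⧸ ev.range)).ne'
  exact (Nat.le_of_dvd (Nat.pos_of_ne_zero hne) hdvd').trans hidx

end Twist


/-! ## §1b Any finite cyclic group of automorphisms whose non-trivial elements fix only the identity -/

namespace Twist.Cyclic

variable {N : Type} [CommGroup N]

/-- **The fixed-point hypothesis for a cyclic group `⟨ρ⟩` of order `n`** whose non-trivial powers `ρ^k` (`0 < k < n`) fix only `1`. [folklore] -/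
theorem hfix (ρ : MulAut N) {n : ℕ} (hn : orderOf ρ = n) (h0 : 0 < n) (hfix1 : ∀ k : ℕ, 0 < k → k < n → ∀ v : N, (ρ ^ k) v = v → v = 1) :
    ∀ f : Subgroup.zpowers ρ, f ≠ 1 → ∀ v w : N, (Subgroup.zpowers ρ).subtype f v = v → (Subgroup.zpowers ρ).subtype f w = w →
      ∃ k l : ℤ, (k ≠ 0 ∨ l ≠ 0) ∧ v ^ k = w ^ l := by
  intro f hf v w hv hw
  have hfin : IsOfFinOrder ρ := isOfFinOrder_iff_pow_eq_one.2 ⟨n, h0, by rw [← hn]; exact pow_orderOf_eq_one ρ⟩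
  have hmem : (f : MulAut N) ∈ (Finset.range (orderOf ρ)).image (ρ ^ ·) := (hfin.mem_zpowers_iff_mem_range_orderOf).1 f.2
  rw [hn, Finset.mem_image] at hmem
  obtain ⟨k, hk, hfk⟩ := hmem
  rw [Finset.mem_range] at hk
  have hk0 : 0 < k := by
    rcases Nat.eq_zero_or_pos k with rfl | h
    · exact absurd (Subtype.ext (by rw [← hfk, pow_zero]; rfl)) hf
    · exact h
  rw [Subgroup.coe_subtype, ← hfk] at hv hw
  refine ⟨1, 1, Or.inl one_ne_zero, ?_⟩
  rw [hfix1 k hk0 hk v hv, hfix1 k hk0 hk w hw]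

/-- **THEOREM (cyclic point groups): `n ∣ [N ⋊ ⟨ρ⟩ : A₀]`** for every subgroup with a rank-two `ℤ²`-character, whenever `ρ ∈ Aut(N)` has order `n ≥ 1` and its
non-trivial powers fix only the identity (`N` abelian) — the rotation groups `p3, p4, p6` (`n = 3, 4, 6` on `ℤ²`) and `ℤ^p ⋊ C_p` restricted to `(1,…,1)^⊥`-free
lattices are instances. [cite: BenjaminiSchramm1996, §2 (almost transitive graphs)] -/
theorem dvd_index (ρ : MulAut N) {n : ℕ} (hn : orderOf ρ = n) (h0 : 0 < n) (hfix1 : ∀ k : ℕ, 0 < k → k < n → ∀ v : N, (ρ ^ k) v = v → v = 1)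
    (A₀ : Subgroup (N ⋊[(Subgroup.zpowers ρ).subtype] (Subgroup.zpowers ρ))) (c : A₀ →* Multiplicative (Site 2))
    (hrank : ∃ x y : A₀, MaxArea.det2 (Multiplicative.toAdd (c x)) (Multiplicative.toAdd (c y)) ≠ 0) : n ∣ A₀.index := by
  have hcard : Nat.card (Subgroup.zpowers ρ) = n := by rw [Nat.card_zpowers, hn]
  haveI : Finite (Subgroup.zpowers ρ) := Nat.finite_of_card_ne_zero (by rw [hcard]; exact h0.ne')
  have h := Twist.dvd_index (hfix ρ hn h0 hfix1) A₀ c hrank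
  rwa [hcard] at h

/-- **… and at least `n` types on a GRR of `N ⋊ ⟨ρ⟩`.** [cite: BenjaminiSchramm1996, Conj. 4; §2 (Cayley graphs)] [cite: LeemannDelasalle2022, Cor. 1.2] -/
theorem le_card_reps_of_grr (ρ : MulAut N) {n : ℕ} (hn : orderOf ρ = n) (h0 : 0 < n)
    (hfix1 : ∀ k : ℕ, 0 < k → k < n → ∀ v : N, (ρ ^ k) v = v → v = 1) (S : Set (N ⋊[(Subgroup.zpowers ρ).subtype] (Subgroup.zpowers ρ)))
    (hGRR : ∀ α : mulCayley S ≃g mulCayley S, ∀ v, α v = α 1 * v) (A : Subgroup (mulCayley S ≃g mulCayley S))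
    (reps : Finset (N ⋊[(Subgroup.zpowers ρ).subtype] (Subgroup.zpowers ρ))) (cA : A →* Multiplicative (Site 2))
    (horb : ∀ w, ∃ x : A, ∃ s ∈ reps, (x : mulCayley S ≃g mulCayley S) s = w)
    (hrank : ∃ x y : A, MaxArea.det2 (Multiplicative.toAdd (cA x)) (Multiplicative.toAdd (cA y)) ≠ 0) : n ≤ reps.card :=
  Twist.le_card_reps_of_grr n (fun A₀ c h => dvd_index ρ hn h0 hfix1 A₀ c h) S hGRR A reps cA horb hrank

end Twist.Cyclic


/-! ## §3 A point group of order six on `ℤ²` (`p6`; its square: `p3`) -/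

namespace Twist

/-- **The hexagonal rotation `ρ₆ : (x, y) ↦ (x − y, x)` of `ℤ²` has order `6` and its non-trivial powers fix only the origin.**  (`ρ₆² : (x,y) ↦ (−y, x−y)`,
`ρ₆³ = −1`, `ρ₆⁴ = −ρ₆`, `ρ₆⁵ = −ρ₆²`.) [folklore] -/
theorem exists_pointGroup_six : ∃ ρ : MulAut (Multiplicative (Site 2)), orderOf ρ = 6 ∧
    ∀ k : ℕ, 0 < k → k < 6 → ∀ v : Multiplicative (Site 2), (ρ ^ k) v = v → v = 1 := by
  let ρ : MulAut (Multiplicative (Site 2)) :=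
    { toFun := fun v => Multiplicative.ofAdd ![Multiplicative.toAdd v 0 - Multiplicative.toAdd v 1, Multiplicative.toAdd v 0]
      invFun := fun v => Multiplicative.ofAdd ![Multiplicative.toAdd v 1, Multiplicative.toAdd v 1 - Multiplicative.toAdd v 0]
      left_inv := fun v => Multiplicative.toAdd.injective (funext fun i => by
        fin_cases i
        · rfl
        · show Multiplicative.toAdd v 0 - (Multiplicative.toAdd v 0 - Multiplicative.toAdd v 1) = Multiplicative.toAdd v 1
          omega)
      right_inv := fun v => Multiplicative.toAdd.injective (funext fun i => by
        fin_cases i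
        · show Multiplicative.toAdd v 1 - (Multiplicative.toAdd v 1 - Multiplicative.toAdd v 0) = Multiplicative.toAdd v 0
          omega
        · rfl)
      map_mul' := fun v w => Multiplicative.toAdd.injective (funext fun i => by
        fin_cases i
        · show Multiplicative.toAdd v 0 + Multiplicative.toAdd w 0 - (Multiplicative.toAdd v 1 + Multiplicative.toAdd w 1) =
            Multiplicative.toAdd v 0 - Multiplicative.toAdd v 1 + (Multiplicative.toAdd w 0 - Multiplicative.toAdd w 1)
          omega
        · rfl) }
  have h0 : ∀ v, Multiplicative.toAdd (ρ v) 0 = Multiplicative.toAdd v 0 - Multiplicative.toAdd v 1 := fun v => rfl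
  have h1 : ∀ v, Multiplicative.toAdd (ρ v) 1 = Multiplicative.toAdd v 0 := fun v => rfl
  -- coordinates of the powers
  have p2 : ∀ v, Multiplicative.toAdd ((ρ ^ 2) v) 0 = -(Multiplicative.toAdd v 1) ∧
      Multiplicative.toAdd ((ρ ^ 2) v) 1 = Multiplicative.toAdd v 0 - Multiplicative.toAdd v 1 := fun v => by
    refine ⟨?_, ?_⟩
    · rw [pow_two, MulAut.mul_apply, h0, h0, h1]; omega
    · rw [pow_two, MulAut.mul_apply, h1, h0]
  have e3 : ρ ^ 3 = ρ * ρ ^ 2 := by rw [show (3 : ℕ) = 1 + 2 from rfl, pow_add, pow_one]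
  have p3 : ∀ v, Multiplicative.toAdd ((ρ ^ 3) v) 0 = -(Multiplicative.toAdd v 0) ∧ Multiplicative.toAdd ((ρ ^ 3) v) 1 = -(Multiplicative.toAdd v 1) :=
    fun v => by
    refine ⟨?_, ?_⟩
    · rw [e3, MulAut.mul_apply, h0, (p2 v).1, (p2 v).2]; omega
    · rw [e3, MulAut.mul_apply, h1, (p2 v).1]
  have e4 : ρ ^ 4 = ρ * ρ ^ 3 := by rw [show (4 : ℕ) = 1 + 3 from rfl, pow_add, pow_one]
  have p4 : ∀ v, Multiplicative.toAdd ((ρ ^ 4) v) 0 = Multiplicative.toAdd v 1 - Multiplicative.toAdd v 0 ∧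
      Multiplicative.toAdd ((ρ ^ 4) v) 1 = -(Multiplicative.toAdd v 0) := fun v => by
    refine ⟨?_, ?_⟩
    · rw [e4, MulAut.mul_apply, h0, (p3 v).1, (p3 v).2]; omega
    · rw [e4, MulAut.mul_apply, h1, (p3 v).1]
  have e5 : ρ ^ 5 = ρ * ρ ^ 4 := by rw [show (5 : ℕ) = 1 + 4 from rfl, pow_add, pow_one]
  have p5 : ∀ v, Multiplicative.toAdd ((ρ ^ 5) v) 0 = Multiplicative.toAdd v 1 ∧
      Multiplicative.toAdd ((ρ ^ 5) v) 1 = Multiplicative.toAdd v 1 - Multiplicative.toAdd v 0 := fun v => by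
    refine ⟨?_, ?_⟩
    · rw [e5, MulAut.mul_apply, h0, (p4 v).1, (p4 v).2]; omega
    · rw [e5, MulAut.mul_apply, h1, (p4 v).1]
  have p6 : ρ ^ 6 = 1 := by
    refine MulEquiv.ext fun v => Multiplicative.toAdd.injective (funext fun i => ?_)
    rw [show (6 : ℕ) = 1 + 5 from rfl, pow_add, pow_one, MulAut.mul_apply, MulAut.one_apply]
    fin_cases i
    · show Multiplicative.toAdd (ρ ((ρ ^ 5) v)) 0 = Multiplicative.toAdd v 0
      rw [h0, (p5 v).1, (p5 v).2]; ring
    · show Multiplicative.toAdd (ρ ((ρ ^ 5) v)) 1 = Multiplicative.toAdd v 1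
      rw [h1, (p5 v).1]
  -- fixed points of the non-trivial powers
  have hfix : ∀ k : ℕ, 0 < k → k < 6 → ∀ v : Multiplicative (Site 2), (ρ ^ k) v = v → v = 1 := by
    intro k hk0 hk v hv
    have e0 := congrArg (fun w : Multiplicative (Site 2) => Multiplicative.toAdd w 0) hv
    have e1 := congrArg (fun w : Multiplicative (Site 2) => Multiplicative.toAdd w 1) hv
    apply Multiplicative.toAdd.injective
    funext i
    rw [toAdd_one, Pi.zero_apply]
    interval_cases k
    · rw [pow_one, h0] at e0; rw [pow_one, h1] at e1
      fin_cases i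
      · show Multiplicative.toAdd v 0 = 0; omega
      · show Multiplicative.toAdd v 1 = 0; omega
    · rw [(p2 v).1] at e0; rw [(p2 v).2] at e1
      fin_cases i
      · show Multiplicative.toAdd v 0 = 0; omega
      · show Multiplicative.toAdd v 1 = 0; omega
    · rw [(p3 v).1] at e0; rw [(p3 v).2] at e1
      fin_cases i
      · show Multiplicative.toAdd v 0 = 0; omega
      · show Multiplicative.toAdd v 1 = 0; omega
    · rw [(p4 v).1] at e0; rw [(p4 v).2] at e1
      fin_cases i
      · show Multiplicative.toAdd v 0 = 0; omega
      · show Multiplicative.toAdd v 1 = 0; omega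
    · rw [(p5 v).1] at e0; rw [(p5 v).2] at e1
      fin_cases i
      · show Multiplicative.toAdd v 0 = 0; omega
      · show Multiplicative.toAdd v 1 = 0; omega
  refine ⟨ρ, (orderOf_eq_iff (by norm_num)).2 ⟨p6, fun m hm hm0 heq => ?_⟩, hfix⟩
  -- no smaller power is trivial: evaluate at `e₀ = (1, 0)`
  have key := hfix m hm0 hm (Multiplicative.ofAdd (Pi.single 0 (1 : ℤ) : Site 2)) (by rw [heq, MulAut.one_apply])
  have h := congrArg (fun w : Multiplicative (Site 2) => Multiplicative.toAdd w 0) key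
  simp only [toAdd_ofAdd, Pi.single_eq_same, toAdd_one, Pi.zero_apply] at h
  exact one_ne_zero h

/-- **A point group of order THREE on `ℤ²`** (the square of the hexagonal rotation): `p3`. [folklore] -/
theorem exists_pointGroup_three : ∃ ρ : MulAut (Multiplicative (Site 2)), orderOf ρ = 3 ∧
    ∀ k : ℕ, 0 < k → k < 3 → ∀ v : Multiplicative (Site 2), (ρ ^ k) v = v → v = 1 := by
  obtain ⟨ρ, hρ, hfix⟩ := exists_pointGroup_six
  refine ⟨ρ ^ 2, ?_, fun k hk0 hk v hv => ?_⟩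
  · rw [orderOf_pow' ρ (by norm_num), hρ]; decide
  · rw [← pow_mul] at hv
    interval_cases k
    · exact hfix 2 (by norm_num) (by norm_num) v hv
    · exact hfix 4 (by norm_num) (by norm_num) v hv

/-- **THEOREM (`p6`: a split planar crystallographic group needing at least SIX types).**  There is `ρ ∈ Aut(ℤ²)` of order six such that every subgroup of
`ℤ² ⋊ ⟨ρ⟩` carrying a `ℤ²`-character of rank two has index divisible by `6` — hence (`Twist.Cyclic.le_card_reps_of_grr`) at least six vertex orbits for every end-state
datum on a GRR. [cite: BenjaminiSchramm1996, Conj. 4; §2] [cite: KozmaNitzan2024, §4 p. 16 (Lemma 8)] -/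
theorem exists_grp_six_types : ∃ ρ : MulAut (Multiplicative (Site 2)), orderOf ρ = 6 ∧
    ∀ (A₀ : Subgroup (Multiplicative (Site 2) ⋊[(Subgroup.zpowers ρ).subtype] (Subgroup.zpowers ρ))) (c : A₀ →* Multiplicative (Site 2)),
      (∃ x y : A₀, MaxArea.det2 (Multiplicative.toAdd (c x)) (Multiplicative.toAdd (c y)) ≠ 0) → 6 ∣ A₀.index := by
  obtain ⟨ρ, hρ, hfix⟩ := exists_pointGroup_six
  exact ⟨ρ, hρ, fun A₀ c hrank => Cyclic.dvd_index ρ hρ (by norm_num) hfix A₀ c hrank⟩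

/-- **… and `p3`: at least THREE types.** [cite: BenjaminiSchramm1996, Conj. 4; §2] -/
theorem exists_grp_three_types : ∃ ρ : MulAut (Multiplicative (Site 2)), orderOf ρ = 3 ∧
    ∀ (A₀ : Subgroup (Multiplicative (Site 2) ⋊[(Subgroup.zpowers ρ).subtype] (Subgroup.zpowers ρ))) (c : A₀ →* Multiplicative (Site 2)),
      (∃ x y : A₀, MaxArea.det2 (Multiplicative.toAdd (c x)) (Multiplicative.toAdd (c y)) ≠ 0) → 3 ∣ A₀.index := by
  obtain ⟨ρ, hρ, hfix⟩ := exists_pointGroup_three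
  exact ⟨ρ, hρ, fun A₀ c hrank => Cyclic.dvd_index ρ hρ (by norm_num) hfix A₀ c hrank⟩

end Twist

end Summit.CriticalPhenomena.PercolationContinuityZ3.Theorems.Transplant

end
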